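import Summits.Ventures.QEC.Census.CertBZPlaneSeg2
import HarnessLib

/-!
# THIRD-ROW lane families for the Brouwer–Zimmermann lane engine: splitting a (largest, second-largest) family once more

Venture QEC (cell `qec`), qec-type-10 gen 3 (census row `A1s_n192_k4_0fa3ae82`, one-level cover certificate: the level-1 code
`C_M` is `[96,48]` and needs depth `8` on a 48-row matrix at threshold `16`). qec-type-01's `Census/CertBZPlaneSeg2.lean` splits the
family of largest row `m` by the second-largest row `p` — but a single pair `(m, p)` still carries `Σ_{w ≤ t−2} C(p, w)` lanes
(`1.1·10⁷` for `(47, 46)` at `t = 8`), above what one `decide +kernel` declaration holds at threshold `17` (kernel memory;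
measured: `3.9·10⁶` lanes pass, `7·10⁶` fail). This file adds ONE more level, in the same style and on the same primitives:
`seg3Family t m p r₀ q` = all selections `S ∪ {r, p, m}` with `r ∈ [r₀, r₀+q)`, `S ⊆ [0, r)`, `|S| ≤ t − 3` (type-01's
`segment (t−2) r₀ q` below row `p`, rows `p` and `m` forced to all-ones), `seg3OK` = `familyOK` on it; **`reaches_of_segs3`**:
segments for the largest rows `< c`; for every `m ∈ [c, |G|)` the singleton `{m}`; for every `p < m` EITHER a listed second-row
range (as in `reaches_of_segs2`) OR the pair `(m, p)` is listed in `dbl`, in which case the bare pair `{p, m}` passes as a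
one-lane second-row family and every third row `r < p` lies in a listed third-row range passing `seg3OK`
⇒ `Reaches (bzLeaf wmax allow) (rowPos G 0) t 0 0`. Definitions + theorems; standard axioms; control on the Steane matrix.
-/

set_option autoImplicit false

namespace Summit.Ventures.QEC.Census.Plane

open List

/-! ## Definitions -/

/-- **The third-row family**: lanes of `segment (t−2) r₀ q` (selections `S ∪ {r}`, `r ∈ [r₀, r₀+q)` largest, `|S| ≤ t−3`)
on the rows `< p`, with rows `p` and `m` selected in EVERY lane (indicator words: the segment's below `p`, all-ones at `p` and
`m`, zero strictly between). (definition) -/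
def seg3Family (t m p r0 q : ℕ) : ℕ × List ℕ :=
  ((segment (t - 2) r0 q).1,
    (List.range (m + 1)).map fun j =>
      if j < p then (segment (t - 2) r0 q).2.getD j 0
      else if j = p ∨ j = m then ones (segment (t - 2) r0 q).1 else 0)

/-- **The third-row check**: `familyOK` (columns `0 … n−1`, threshold `wmax + 1`, stragglers re-checked by `bzLeaf`) on
`seg3Family t m p r₀ q`. (definition) -/
def seg3OK (n wmax : ℕ) (allow G : List ℕ) (t m p r0 q fuel : ℕ) : Bool :=
  familyOK wmax (List.range n) allow G (seg3Family t m p r0 q) (wmax + 1) fuel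

/-! ## Coverage -/

/-- **The third-row family covers `J ++ [r] ++ [p] ++ [m]`** for `r ∈ [r₀, r₀+q)`, `r < p < m`, `J` strictly increasing below
`r` with `|J| ≤ t − 3`. -/
theorem covers_seg3 (t m p r0 q : ℕ) {r : ℕ} (hr0 : r0 ≤ r) (hrq : r < r0 + q) (hrp : r < p) (hpm : p < m) (J : List ℕ)
    (hJ : J.Pairwise (· < ·)) (hlt : ∀ j ∈ J, j < r) (hlen : J.length ≤ t - 3) :
    Covers (seg3Family t m p r0 q) (J ++ [r] ++ [p] ++ [m]) := by
  obtain ⟨b, hb, hbits⟩ := covers_segment (t - 2) r0 q hr0 hrq J hJ hlt (by omega)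
  refine ⟨b, hb, fun j => ?_⟩
  show (((List.range (m + 1)).map fun j => if j < p then (segment (t - 2) r0 q).2.getD j 0
      else if j = p ∨ j = m then ones (segment (t - 2) r0 q).1 else 0).getD j 0).testBit b =
    decide (j ∈ J ++ [r] ++ [p] ++ [m])
  have hJ' : ∀ x ∈ J, x < r := hlt
  by_cases hjm : j ≤ m
  · rw [List.getD_eq_getElem?_getD, List.getElem?_map, List.getElem?_range (Nat.lt_succ_of_le hjm), Option.map_some,
      Option.getD_some]
    by_cases hjp : j < p
    · rw [if_pos hjp, hbits j]
      have h1 : j ≠ p := by omega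
      have h2 : j ≠ m := by omega
      by_cases hmem : j ∈ J ++ [r]
      · rw [decide_eq_true hmem, decide_eq_true (by simp only [List.mem_append] at hmem ⊢; tauto)]
      · rw [decide_eq_false hmem, decide_eq_false (by
          simp only [List.mem_append, List.mem_singleton] at hmem ⊢; tauto)]
    · rw [if_neg hjp]
      by_cases hj2 : j = p ∨ j = m
      · rw [if_pos hj2, testBit_ones, decide_eq_true hb, decide_eq_true (by
          simp only [List.mem_append, List.mem_singleton]; tauto)]
      · rw [if_neg hj2, Nat.zero_testBit]
        have h1 : j ∉ J := fun h => by have := hJ' j h; omega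
        have h2 : j ≠ r := by omega
        rw [decide_eq_false (by simp only [List.mem_append, List.mem_singleton]; tauto)]
  · rw [List.getD_eq_getElem?_getD, List.getElem?_eq_none (by simp; omega), Option.getD_none, Nat.zero_testBit]
    have h1 : j ∉ J := fun h => by have := hJ' j h; omega
    have h2 : j ≠ r := by omega
    have h3 : j ≠ p := by omega
    have h4 : j ≠ m := by omega
    rw [decide_eq_false (by simp only [List.mem_append, List.mem_singleton]; tauto)]

/-! ## Assembly -/

/-- **SOUNDNESS OF THE THIRD-ROW REPLAY.** Let the rows of `G` (`|G| = c + K`) be words below `2^n`. Suppose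
(i) every largest row `m < c` lies in a listed segment passing `segOK … t m₀ s`;
(ii) every `m ∈ [c, c+K)` is listed in `sing` and its singleton family passes;
(iii) for every `m ∈ [c, c+K)` and `p < m`: some listed second-row range `(m, p₀, q)` contains `p` (all listed ranges pass
`seg2OK … t m p₀ q`), OR the pair `(m, p)` is listed in `dbl`;
(iv) every listed pair `(m, p) ∈ dbl` passes as the bare pair (`seg2OK … 2 m p 1`), and for every `r < p` some listed
third-row range `(m, p, r₀, q)` contains `r`; every listed third-row range passes `seg3OK … t m p r₀ q`.
Then `Reaches (bzLeaf wmax allow) (rowPos G 0) t 0 0`. -/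
theorem reaches_of_segs3 (n wmax : ℕ) (allow G : List ℕ) (c K t fuel : ℕ) (hG : ∀ g ∈ G, g < 2 ^ n)
    (hlen : G.length = c + K) (segs : List (ℕ × ℕ))
    (hcov : ((List.range c).all fun m => segs.any fun r => decide (r.1 ≤ m) && decide (m < r.1 + r.2)) = true)
    (hseg : ∀ r ∈ segs, segOK n wmax allow G t r.1 r.2 fuel = true)
    (sing : List ℕ) (hsingcov : ((List.range' c K).all fun m => sing.elem m) = true)
    (hsing : ∀ m ∈ sing, segOK n wmax allow G 1 m 1 fuel = true)
    (pairs : List (ℕ × ℕ × ℕ)) (dbl : List (ℕ × ℕ))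
    (hpcov : ((List.range' c K).all fun m => (List.range m).all fun p =>
      (pairs.any fun r => decide (r.1 = m) && decide (r.2.1 ≤ p) && decide (p < r.2.1 + r.2.2)) || dbl.elem (m, p)) = true)
    (hpairs : ∀ r ∈ pairs, seg2OK n wmax allow G t r.1 r.2.1 r.2.2 fuel = true)
    (hdbl : ∀ d ∈ dbl, seg2OK n wmax allow G 2 d.1 d.2 1 fuel = true)
    (triples : List (ℕ × ℕ × ℕ × ℕ))
    (htcov : (dbl.all fun d => (List.range d.2).all fun r =>
      triples.any fun x => decide (x.1 = d.1) && decide (x.2.1 = d.2) && decide (x.2.2.1 ≤ r) && decide (r < x.2.2.1 + x.2.2.2))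
      = true)
    (htriples : ∀ x ∈ triples, seg3OK n wmax allow G t x.1 x.2.1 x.2.2.1 x.2.2.2 fuel = true) :
    Reaches (bzLeaf wmax allow) (rowPos G 0) t 0 0 := by
  intro S hS hSl
  rw [Nat.zero_xor, Nat.zero_xor]
  obtain ⟨J, hJsub, rfl⟩ := exists_map_of_sublist_rowPos G hS
  have hJp : J.Pairwise (· < ·) := List.Pairwise.sublist hJsub List.pairwise_lt_range
  have hJlt : ∀ j ∈ J, j < G.length := fun j hj => List.mem_range.1 (hJsub.subset hj)
  rw [List.length_map] at hSl
  rcases List.eq_nil_or_concat J with rfl | ⟨J', m, rfl⟩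
  · simp [xorFst, xorSnd, xorList, bzLeaf]
  · rw [List.concat_eq_append] at hJp hJlt hSl ⊢
    have hJ'p : J'.Pairwise (· < ·) := (List.pairwise_append.1 hJp).1
    have hJ'm : ∀ j ∈ J', j < m := fun j hj => (List.pairwise_append.1 hJp).2.2 j hj m (List.mem_singleton_self m)
    have hmG : m < G.length := hJlt m (by simp)
    by_cases hmc : m < c
    · -- (i) largest row below the cut: a passing segment
      simp only [List.all_eq_true, List.mem_range, List.any_eq_true, Bool.and_eq_true, decide_eq_true_eq] at hcov
      obtain ⟨r, hr, h1, h2⟩ := hcov m hmc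
      have hJ'l : J'.length ≤ t - 1 := by rw [List.length_append, List.length_singleton] at hSl; omega
      obtain ⟨b, hb, hbits⟩ := covers_segment t r.1 r.2 h1 h2 J' hJ'p hJ'm hJ'l
      have hok := hseg r hr
      rw [segOK] at hok
      exact leaf_of_familyOK_covers n wmax allow G fuel hG _ hok _ hJp hJlt hb hbits
    · have hmr : m ∈ List.range' c K := by rw [List.mem_range'_1]; omega
      rcases List.eq_nil_or_concat J' with hJ'0 | ⟨J'', p, hJ'e⟩
      · -- (ii) the singleton `{m}`
        subst hJ'0
        rw [List.all_eq_true] at hsingcov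
        have hms : m ∈ sing := List.mem_of_elem_eq_true (hsingcov m hmr)
        have hok := hsing m hms
        rw [segOK] at hok
        obtain ⟨b, hb, hbits⟩ := covers_segment 1 m 1 (le_refl m) (by omega) [] List.Pairwise.nil
          (fun _ h => by simp at h) (by simp)
        exact leaf_of_familyOK_covers n wmax allow G fuel hG _ hok _ hJp hJlt hb hbits
      · subst hJ'e
        rw [List.concat_eq_append] at hJ'p hJ'm hJp hJlt hSl ⊢
        have hpm : p < m := hJ'm p (by simp)
        have hJ''p : J''.Pairwise (· < ·) := (List.pairwise_append.1 hJ'p).1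
        have hJ''lt : ∀ j ∈ J'', j < p := fun j hj =>
          (List.pairwise_append.1 hJ'p).2.2 j hj p (List.mem_singleton_self p)
        have hJ''l : J''.length ≤ t - 2 := by
          rw [List.length_append, List.length_append, List.length_singleton, List.length_singleton] at hSl; omega
        simp only [List.all_eq_true, List.mem_range, Bool.or_eq_true, List.any_eq_true, Bool.and_eq_true,
          decide_eq_true_eq] at hpcov
        rcases hpcov m hmr p hpm with ⟨r, hr, ⟨hrm, h1⟩, h2⟩ | hdb
        · -- (iii) a listed second-row range
          obtain ⟨b, hb, hbits⟩ := covers_seg2 t m r.2.1 r.2.2 h1 h2 hpm J'' hJ''p hJ''lt hJ''l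
          have hok := hpairs r hr
          rw [seg2OK, hrm] at hok
          exact leaf_of_familyOK_covers n wmax allow G fuel hG _ hok _ hJp hJlt hb hbits
        · -- (iv) a doubled pair: split by the third-largest row
          have hdmem : (m, p) ∈ dbl := List.mem_of_elem_eq_true hdb
          rcases List.eq_nil_or_concat J'' with hJ''0 | ⟨J''', r, hJ''e⟩
          · -- the bare pair `{p, m}`
            subst hJ''0
            have hok := hdbl (m, p) hdmem
            rw [seg2OK] at hok
            obtain ⟨b, hb, hbits⟩ := covers_seg2 2 m p 1 (le_refl p) (by omega) hpm [] List.Pairwise.nil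
              (fun _ h => by simp at h) (by simp)
            exact leaf_of_familyOK_covers n wmax allow G fuel hG _ hok _ hJp hJlt hb hbits
          · subst hJ''e
            rw [List.concat_eq_append] at hJ''p hJ''lt hJ'p hJ'm hJp hJlt hSl ⊢
            have hrp : r < p := hJ''lt r (by simp)
            have hJ3p : J'''.Pairwise (· < ·) := (List.pairwise_append.1 hJ''p).1
            have hJ3lt : ∀ j ∈ J''', j < r := fun j hj =>
              (List.pairwise_append.1 hJ''p).2.2 j hj r (List.mem_singleton_self r)
            have hJ3l : J'''.length ≤ t - 3 := by
              simp only [List.length_append, List.length_singleton] at hSl; omega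
            simp only [List.all_eq_true, List.mem_range, List.any_eq_true, Bool.and_eq_true, decide_eq_true_eq] at htcov
            obtain ⟨x, hx, ⟨⟨hx1, hx2⟩, h1⟩, h2⟩ := htcov (m, p) hdmem r hrp
            obtain ⟨b, hb, hbits⟩ := covers_seg3 t m p x.2.2.1 x.2.2.2 h1 h2 hrp hpm J''' hJ3p hJ3lt hJ3l
            have hok := htriples x hx
            rw [seg3OK, hx1, hx2] at hok
            exact leaf_of_familyOK_covers n wmax allow G fuel hG _ hok _ hJp hJlt hb hbits

/-! ## Control (the Steane matrix of `Census/CertBZPlane.lean`: 4 rows of 7 bits; cut `c = 2`, budget 3) -/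

/-- Control: largest rows `0, 1` by one segment; rows `2, 3` by their singletons; second rows of `2` by the range `(2,0,2)`, of
`3` by the range `(3,0,2)` and the DOUBLED pair `(3,2)` (bare pair + third-row range `(3,2,0,2)`): every non-empty selection
of `≤ 3` rows of the Steane matrix has weight `≥ 3` (threshold `wmax = 2`) — and `seg3OK` on its own, to keep the statement new. -/
theorem reaches_steane_seg3 :
    Reaches (bzLeaf 2 []) (rowPos steaneG 0) 3 0 0 ∧ seg3OK 7 2 [] steaneG 3 3 2 0 2 1 = true :=
  ⟨reaches_of_segs3 7 2 [] steaneG 2 2 3 1 (by decide) (by decide) [(0, 2)] (by decide)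
      (by intro r hr; simp only [List.mem_singleton] at hr; subst hr; decide)
      [2, 3] (by decide) (by intro m hm; simp only [List.mem_cons, List.not_mem_nil, or_false] at hm; rcases hm with rfl | rfl <;> decide)
      [(2, 0, 2), (3, 0, 2)] [(3, 2)] (by decide)
      (by intro r hr; simp only [List.mem_cons, List.not_mem_nil, or_false] at hr; rcases hr with rfl | rfl <;> decide)
      (by intro d hd; simp only [List.mem_singleton] at hd; subst hd; decide)
      [(3, 2, 0, 2)] (by decide)
      (by intro x hx; simp only [List.mem_singleton] at hx; subst hx; decide),
    by decide⟩

end Summit.Ventures.QEC.Census.Plane
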